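import Literature.AlgebraicGeometry.Resolution.LogRegularResolution
import Mathlib.LinearAlgebra.Dimension.Finrank
import Mathlib.LinearAlgebra.Span.Basic
import HarnessLib

/-!
# Crux `FrobeniusLadder.FRationalResolution` (stmt-ResolutionOfSingularities-15317), line `redirect`,
# stub `stub_diagonalizableQuotientResolution` — Kato's regularity condition is invariant under
# RE-PARAMETRISATION of the chart monoid by an injective linear map of the ambient lattice
# (chart normalisation R4, second brick)

The monomial chart of `…FixedPointLogRegular` lives on `P = ℤⁿ_{≥0} ⊓ ker (m ↦ Σ mᵢ aᵢ)`, whose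
group `Pᵍᵖ = ker(ℤⁿ → A')` has finite index in `ℤⁿ` but is not `ℤⁿ`; the tree's log atlases want
spanning, saturated chart monoids. Choosing a `ℤ`-basis of `Pᵍᵖ` gives an injective linear
`L : ℤⁿ → ℤⁿ` with `P' := L⁻¹ P` spanning and saturated and `L : P' ≅ P`. This file proves that
Kato's condition (2.1) (`LogChart.IsLogRegularAt`) is the same for `(P, φ)` and `(P', φ ∘ L)`:
Kato's ideal is literally the same, the faces correspond under `L`, and an injective linear map
preserves the rank of the span of the face.

* `ideal_comp_eq`, `face_comp_eq` — Kato's ideal and face under re-parametrisation;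
* `isLogRegularAt_comp_iff` — `IsLogRegularAt P' (φ ∘ e) 𝔭 ↔ IsLogRegularAt P φ 𝔭` for a monoid
  isomorphism `e : P' ≃+ P` induced by an injective linear endomorphism `L` of `ℤⁿ`.

Honest label: bookkeeping brick (no stub closed; the existence of the basis / the spanning
saturated `P'` is not here). No definitions, no named facts, no sorry. [cite: Kato1994, Def. (2.1)]
-/

-- single-problem summit: the doubled namespace component is forced
set_option linter.dupNamespace false

open Literature.AlgebraicGeometry.Resolution

namespace Summit.ResolutionOfSingularities.ResolutionOfSingularities.Theorems.FRationalResolution.LogChartTransport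

universe u

variable {A : Type u} [CommRing A] {n : ℕ} (P P' : AddSubmonoid (Fin n → ℤ))
  (e : P' ≃+ P) (φ : Multiplicative P →* A)

/-- Kato's ideal is unchanged by re-parametrising the chart along a monoid isomorphism.
[cite: Kato1994, Def. (2.1)] -/
theorem ideal_comp_eq (𝔭 : Ideal A) :
    LogChart.ideal P' (φ.comp (AddMonoidHom.toMultiplicative e.toAddMonoidHom)) 𝔭 =
      LogChart.ideal P φ 𝔭 := by
  unfold LogChart.ideal
  congr 1
  ext a
  simp only [Set.mem_image, Set.mem_setOf_eq, MonoidHom.coe_comp, Function.comp_apply,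
    AddMonoidHom.toMultiplicative_apply_apply, AddEquiv.toAddMonoidHom_eq_coe, AddMonoidHom.coe_coe,
    toAdd_ofAdd]
  constructor
  · rintro ⟨p', hp', rfl⟩
    exact ⟨e p', hp', rfl⟩
  · rintro ⟨p, hp, rfl⟩
    refine ⟨e.symm p, ?_, ?_⟩ <;> simp [hp]

/-- The face of the re-parametrised chart is the preimage of the face. [cite: Kato1994, Def. (2.1)] -/
theorem face_comp_eq (𝔭 : Ideal A) :
    LogChart.face P' (φ.comp (AddMonoidHom.toMultiplicative e.toAddMonoidHom)) 𝔭 =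
      e ⁻¹' LogChart.face P φ 𝔭 := by
  ext p'
  simp [LogChart.face]

/-- **Kato's condition (2.1) is invariant under re-parametrisation of the chart monoid by an
injective linear endomorphism of the ambient lattice**: if `L : ℤⁿ → ℤⁿ` is injective and
restricts to a monoid isomorphism `e : P' ≃ P` (`L p' = e p'`), then for every chart `φ : P → A` and
prime `𝔭`, `IsLogRegularAt P' (φ ∘ e) 𝔭 ↔ IsLogRegularAt P φ 𝔭`. [cite: Kato1994, Def. (2.1)] -/
theorem isLogRegularAt_comp_iff (L : (Fin n → ℤ) →ₗ[ℤ] (Fin n → ℤ)) (hL : Function.Injective L)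
    (heL : ∀ p' : P', L (p' : Fin n → ℤ) = (e p' : Fin n → ℤ)) (𝔭 : Ideal A) [𝔭.IsPrime] :
    LogChart.IsLogRegularAt P' (φ.comp (AddMonoidHom.toMultiplicative e.toAddMonoidHom)) 𝔭 ↔
      LogChart.IsLogRegularAt P φ 𝔭 := by
  have hideal := ideal_comp_eq P P' e φ 𝔭
  -- the spans of the faces have the same rank
  have himg : (fun p : P => (p : Fin n → ℤ)) '' LogChart.face P φ 𝔭 =
      L '' ((fun p' : P' => (p' : Fin n → ℤ)) ''
        LogChart.face P' (φ.comp (AddMonoidHom.toMultiplicative e.toAddMonoidHom)) 𝔭) := by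
    rw [face_comp_eq, Set.image_image]
    ext v
    simp only [Set.mem_image, Set.mem_preimage, heL]
    constructor
    · rintro ⟨p, hp, rfl⟩
      exact ⟨e.symm p, by simpa using hp, by simp⟩
    · rintro ⟨p', hp', rfl⟩
      exact ⟨e p', hp', rfl⟩
  have hrank : Module.finrank ℤ (Submodule.span ℤ ((fun p : P => (p : Fin n → ℤ)) ''
      LogChart.face P φ 𝔭)) = Module.finrank ℤ (Submodule.span ℤ ((fun p' : P' =>
        (p' : Fin n → ℤ)) '' LogChart.face P' (φ.comp
          (AddMonoidHom.toMultiplicative e.toAddMonoidHom)) 𝔭)) := by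
    rw [himg, Submodule.span_image]
    exact (LinearEquiv.finrank_eq (Submodule.equivMapOfInjective L hL _)).symm
  unfold LogChart.IsLogRegularAt
  rw [hideal, hrank]

end Summit.ResolutionOfSingularities.ResolutionOfSingularities.Theorems.FRationalResolution.LogChartTransport
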